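import Mathlib
import Summits.Schanuel.Schanuel.Theses.RootDecomp1B

/-!
# RootDecomp1B — glue of the round-3 split of `NoDefectOneFirstFailure` (lens-4 gen 3 v3.1 «PolarSurplusBudget»)

Proves the generated glue item `NoDefectOneFirstFailureGlue` (stmt-Schanuel-27216) of
route-Schanuel-RootDecomp1B rev 3–5:
`LocalSurplusBudget → NoEntangledFirstFailure → NoDefectOneFirstFailure`
(stmt-Schanuel-27214 → stmt-Schanuel-27215 → stmt-Schanuel-25470).

The proof is pure logic: at a ℚ-free real `m`-tuple `r` satisfying the Klein induction hypothesis,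
`LocalSurplusBudget` supplies the side-surplus budget inequality `2m + ρ ≤ a + b`, which is exactly the
extra hypothesis `NoEntangledFirstFailure` asks for; the two side hypotheses of
`NoDefectOneFirstFailure` are not needed (the lens's one-liner `noDefectOneFirstFailure_of_split`,
HOME/decomp-schanuel-lens-4/g3/glue.split31.lean; critic probe CriticProbe1Brev5.glue_holds,
VERDICT 2026-08-30T04:02:57Z). 0 sorry.
-/

set_option linter.dupNamespace false

namespace Summit.Schanuel.Schanuel.Theorems.RootDecomp1B

open Summit.Schanuel.Schanuel.Theses.RootDecomp1B

/-- Item stmt-Schanuel-27216: `LocalSurplusBudget → NoEntangledFirstFailure → NoDefectOneFirstFailure`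
(the budget-sign cut at a first failure: under the Klein induction hypothesis the local budget makes
`σ(r) ≥ 0` available, and `NoEntangledFirstFailure` then upgrades defect one to defect zero). -/
theorem noDefectOneFirstFailureGlue_holds : NoDefectOneFirstFailureGlue :=
  fun hLSB hOne m r hr hIH _ _ hT => hOne m r hr hIH (hLSB m r hr hIH) hT

end Summit.Schanuel.Schanuel.Theorems.RootDecomp1B
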